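import Summits.BirchSwinnertonDyer.Rank1Residual.GaloisImage.HauptmodulThreeQuarticValuation
import HarnessLib

/-!
# The non-canonical root of the level-`3` Hauptmodul quartic at `v₃(j) = 3`, `j/27 ≡ 5 (mod 9)`:
# `v(u)³ = v(3)` for `u = S/3 − 1` and `v(G₋ G₊) = v(3)² v(u)²` for the two factors of `9(u + 1)² − u⁶`
# (cell `b2b-bsdres`, team n1011, seat p02 gen 5 — row T-b11-F4, file F4c-H9 'Hauptmodul route,
# curve-free core at v₃(j) = 3, part 1'; pure valuation algebra in `ℚ̄`)

HONEST FRAMING (cell `b2b-bsdres`, run/shared/lean/b2b/bsd-rank1-residual/, verbatim in every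
file): the goal of the cell is to DELETE the COMBINATION-SHAPED residual classes of the
Birch–Swinnerton-Dyer formula for ALL analytic-rank `≤ 1` elliptic curves over `ℚ` — "full BSD
formula for every rank `≤ 1` curve in class `C`" assembled STRICTLY from published theorems — so
that the rank-`≤ 1` remainder becomes exactly the CONSTRUCTION-SHAPED classes, which are TYPED
(missing-input `Prop`s), NOT attempted. This is not "finishing BSD". Team n1011 (N10 / N11):
research route; no claim beyond the stated classes; labels UNCHANGED; nothing is booked. Theorems
only (no definition, no named fact).

## What this file proves

`v` the place of `ℚ̄` over `3`, `t = v(3)`.  With `L = j/27` and `u = S/3 − 1` the level-`3`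
relation `j(S − 27) = S(S − 24)³` reads `u⁴ − 20u³ + 126u² − (196 + L)u + (8L − 343) = 0`.
On the family `v₃(j) = 3`, `L ≡ 5 (mod 9)` (i.e. `v(L − 5) ≤ t²`):

* `valuation_facts_of_sub_five` (§0) — `v(8L − 343) = t`, `v(196 + L) ≤ t`, `v(403 − 8L) = t`,
  `v(253 + L) ≤ t`, `v(8L − 283) ≤ t²`, `v(139 + L) ≤ t²`.
* `valuation_u_pow_three_eq` (§1) — `v(u + 1) = 1` (non-canonical `S`) and the quartic ⟹
  **`v(u)³ = t`**.
* `valuation_factors_of_quartic_three` (§2) — for `G₋ = (403 − 8L) + (253 + L)u − 129u²`,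
  `G₊ = (8L − 283) − (139 + L)u + 123u²` (so that `G∓ = 3(u + 1)(20 − u) ∓ P`,
  `P = (8L − 343) − (196 + L)u + 126u² = u³(20 − u)`): **`v(G₋)·v(G₊) = t²·v(u)²`**
  (`G₋` is dominated by its constant term, `G₊` by `123u²`).

Part 2 (`HauptmodulNineValuationThree`) concludes `v(X³ − 1)³ = t²` for `X = (3θ/(S − 3))²`
(`θ³ = S`; `(X³ − 1)u⁶(20 − u)² = G₋G₊`), hence `v(X − 1)⁹ = t²`: the `Stab(C)`-invariant
`(3θ/(θ³ − 3))² − 1` has `3`-adic valuation `2/9` on the sub-family `j/27 ≡ 5 (mod 9)` of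
`v₃(j) = 3` of the EXOTIC core (84 census cells; EVIDENCE kit j134538, 84/84; the 27 cells with
`j/27 ≡ 8 (mod 9)` are NOT covered by this invariant).  Nothing booked.

References: [Maier2006] Table 4 (N = 3, 9), §5.
-/

noncomputable section

set_option maxRecDepth 10000

open scoped Classical

namespace Summit.BirchSwinnertonDyer.Rank1Residual.GaloisImage

open Literature.NumberTheory.EllipticCurves Literature.NumberTheory.GaloisRepresentations
  Rat.HeightOneSpectrum

/-! ### §0 Consequences of `L ≡ 5 (mod 9)` -/

/-- The six valuation facts used below, from `v(L − 5) ≤ v(3)²`: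
`8L − 343 = 8(L − 5) − 3·101`, `196 + L = 3·67 + (L − 5)`, `403 − 8L = 3·121 − 8(L − 5)`,
`253 + L = 3·86 + (L − 5)`, `8L − 283 = 8(L − 5) − 3⁵`, `139 + L = 9·16 + (L − 5)`. [folklore] -/
theorem valuation_facts_of_sub_five {L : AlgebraicClosure ℚ}
    (hL : (placeOver 3).valuation (L - 5) ≤ (placeOver 3).valuation (3 : AlgebraicClosure ℚ) ^ 2) :
    (placeOver 3).valuation (8 * L - 343) = (placeOver 3).valuation (3 : AlgebraicClosure ℚ) ∧
    (placeOver 3).valuation (196 + L) ≤ (placeOver 3).valuation (3 : AlgebraicClosure ℚ) ∧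
    (placeOver 3).valuation (403 - 8 * L) = (placeOver 3).valuation (3 : AlgebraicClosure ℚ) ∧
    (placeOver 3).valuation (253 + L) ≤ (placeOver 3).valuation (3 : AlgebraicClosure ℚ) ∧
    (placeOver 3).valuation (8 * L - 283) ≤ (placeOver 3).valuation (3 : AlgebraicClosure ℚ) ^ 2 ∧
    (placeOver 3).valuation (139 + L) ≤ (placeOver 3).valuation (3 : AlgebraicClosure ℚ) ^ 2 := by
  set v := (placeOver 3).valuation with hv
  set t := v (3 : AlgebraicClosure ℚ) with ht
  have ht1 : t < 1 := valuation_three_lt_one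
  have ht0 : t ≠ 0 := valuation_three_ne_zero
  have hunit : ∀ n : ℤ, ¬ (3 : ℤ) ∣ n → v (n : AlgebraicClosure ℚ) = 1 := fun n hn ↦
    valuation_intCast_eq_one_of_not_dvd hn
  have ht2t : t ^ 2 < t := by
    calc t ^ 2 = t * t := pow_two t
      _ < t * 1 := mul_lt_mul_of_pos_left ht1 (zero_lt_iff.mpr ht0)
      _ = t := mul_one t
  have h8 : v (8 * (L - 5)) ≤ t ^ 2 := by
    rw [map_mul]
    calc v 8 * v (L - 5) ≤ 1 * t ^ 2 := mul_le_mul' (by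
          have := hunit 8 (by decide); exact_mod_cast this.le) hL
      _ = t ^ 2 := one_mul _
  -- `v(3·k) = t` for `k` prime to `3`
  have h3k : ∀ k : ℤ, ¬ (3 : ℤ) ∣ k → v ((3 * k : ℤ) : AlgebraicClosure ℚ) = t := by
    intro k hk; rw [Int.cast_mul, map_mul, Int.cast_ofNat, hunit k hk, mul_one]
  refine ⟨?_, ?_, ?_, ?_, ?_, ?_⟩
  · have e : (8 : AlgebraicClosure ℚ) * L - 343 = 8 * (L - 5) - ((3 * 101 : ℤ) : AlgebraicClosure ℚ) := by
      push_cast; ring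
    rw [e, valuation_sub_eq_of_lt' (by rw [h3k 101 (by decide)]; exact h8.trans_lt ht2t),
      h3k 101 (by decide)]
  · have e : (196 : AlgebraicClosure ℚ) + L = ((3 * 67 : ℤ) : AlgebraicClosure ℚ) + (L - 5) := by
      push_cast; ring
    rw [e]
    exact (Valuation.map_add _ _ _).trans (max_le (h3k 67 (by decide)).le (hL.trans ht2t.le))
  · have e : (403 : AlgebraicClosure ℚ) - 8 * L = ((3 * 121 : ℤ) : AlgebraicClosure ℚ) - 8 * (L - 5) := by
      push_cast; ring
    rw [e, valuation_sub_eq_of_lt (by rw [h3k 121 (by decide)]; exact h8.trans_lt ht2t),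
      h3k 121 (by decide)]
  · have e : (253 : AlgebraicClosure ℚ) + L = ((3 * 86 : ℤ) : AlgebraicClosure ℚ) + (L - 5) := by
      push_cast; ring
    rw [e]
    exact (Valuation.map_add _ _ _).trans (max_le (h3k 86 (by decide)).le (hL.trans ht2t.le))
  · have e : (8 : AlgebraicClosure ℚ) * L - 283 = 8 * (L - 5) - 3 ^ 5 := by ring
    rw [e]
    refine (Valuation.map_sub _ _ _).trans (max_le h8 ?_)
    rw [map_pow]
    exact pow_le_pow_right_of_le_one' ht1.le (by norm_num)
  · have e : (139 : AlgebraicClosure ℚ) + L = 16 * 3 ^ 2 + (L - 5) := by ring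
    rw [e]
    refine (Valuation.map_add _ _ _).trans (max_le ?_ hL)
    rw [map_mul, map_pow]
    calc v 16 * t ^ 2 ≤ 1 * t ^ 2 := mul_le_mul' (by
          have := hunit 16 (by decide); exact_mod_cast this.le) le_rfl
      _ = t ^ 2 := one_mul _

/-! ### §1 `v(u)³ = v(3)` -/

/-- **`v(u)³ = v(3)`** for a root `u` of `u⁴ − 20u³ + 126u² − (196 + L)u + (8L − 343)` with
`v(8L − 343) = v(3)`, `v(196 + L) ≤ v(3)` and `v(u + 1) = 1` (the non-canonical roots):
`u³(u − 20)` balances the constant term. [folklore] -/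
theorem valuation_u_pow_three_eq {u L : AlgebraicClosure ℚ}
    (h343 : (placeOver 3).valuation (8 * L - 343) = (placeOver 3).valuation (3 : AlgebraicClosure ℚ))
    (h196 : (placeOver 3).valuation (196 + L) ≤ (placeOver 3).valuation (3 : AlgebraicClosure ℚ))
    (hu1 : (placeOver 3).valuation (u + 1) = 1)
    (hq : u ^ 4 - 20 * u ^ 3 + 126 * u ^ 2 - (196 + L) * u + (8 * L - 343) = 0) :
    (placeOver 3).valuation u ^ 3 = (placeOver 3).valuation (3 : AlgebraicClosure ℚ) := by
  set v := (placeOver 3).valuation with hv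
  set t := v (3 : AlgebraicClosure ℚ) with ht
  have ht1 : t < 1 := valuation_three_lt_one
  have ht0 : t ≠ 0 := valuation_three_ne_zero
  have ht0' : 0 < t := zero_lt_iff.mpr ht0
  have hle1 : ∀ n : ℕ, v (n : AlgebraicClosure ℚ) ≤ 1 := fun n ↦
    ((placeOver 3).valuation_le_one_iff _).mpr (natCast_mem (placeOver 3) n)
  have h126 : ∀ x : AlgebraicClosure ℚ, v x ≤ 1 → v (126 * x) ≤ t ^ 2 := by
    intro x hx
    rw [show (126 : AlgebraicClosure ℚ) = 14 * 3 ^ 2 by norm_num, map_mul, map_mul, map_pow]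
    calc v 14 * t ^ 2 * v x ≤ 1 * t ^ 2 * 1 :=
          mul_le_mul' (mul_le_mul' (by exact_mod_cast hle1 14) le_rfl) hx
      _ = t ^ 2 := by rw [one_mul, mul_one]
  have ht2t : t ^ 2 < t := by
    calc t ^ 2 = t * t := pow_two t
      _ < t * 1 := mul_lt_mul_of_pos_left ht1 ht0'
      _ = t := mul_one t
  have hule : v u ≤ 1 := by
    have : u = (u + 1) - 1 := by ring
    rw [this]
    exact (Valuation.map_sub _ _ _).trans (max_le hu1.le (by rw [map_one]))
  have hu20 : v (u - 20) = 1 := by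
    have e : u - 20 = (u + 1) - 21 := by ring
    have hlt : v (21 : AlgebraicClosure ℚ) < v (u + 1) := by
      rw [hu1, show (21 : AlgebraicClosure ℚ) = 7 * 3 by norm_num, map_mul]
      calc v 7 * t ≤ 1 * t := mul_le_mul' (by exact_mod_cast hle1 7) le_rfl
        _ = t := one_mul t
        _ < 1 := ht1
    rw [e, valuation_sub_eq_of_lt hlt, hu1]
  -- upper bound
  have hup : v u ^ 3 ≤ t := by
    have hid : u ^ 3 * (u - 20) = -(126 * u ^ 2 - (196 + L) * u + (8 * L - 343)) := by
      linear_combination hq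
    have := congrArg v hid
    rw [map_mul, map_pow, hu20, mul_one, Valuation.map_neg] at this
    rw [this]
    refine (Valuation.map_add _ _ _).trans (max_le ?_ h343.le)
    refine (Valuation.map_sub _ _ _).trans (max_le ((h126 _ (by rw [map_pow]; exact pow_le_one₀ zero_le hule)).trans ht2t.le) ?_)
    rw [map_mul]
    calc v (196 + L) * v u ≤ t * 1 := mul_le_mul' h196 hule
      _ = t := mul_one t
  -- lower bound
  refine le_antisymm hup (not_lt.mp fun hlt ↦ ?_)
  have hult1 : v u < 1 := by
    by_contra h
    rw [not_lt] at h
    have : (1 : _) ≤ v u ^ 3 := one_le_pow₀ h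
    exact absurd (lt_of_le_of_lt this hlt) (not_lt.mpr ht1.le)
  have hid : 8 * L - 343 = -u ^ 4 + 20 * u ^ 3 - 126 * u ^ 2 + (196 + L) * u := by
    linear_combination hq
  have hR : v (-u ^ 4 + 20 * u ^ 3 - 126 * u ^ 2 + (196 + L) * u) < t := by
    have l1 : v (-u ^ 4) < t := by
      rw [Valuation.map_neg, map_pow]
      calc v u ^ 4 = v u ^ 3 * v u := pow_succ _ _
        _ ≤ v u ^ 3 * 1 := mul_le_mul' le_rfl hule
        _ = v u ^ 3 := mul_one _
        _ < t := hlt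
    have l2 : v (20 * u ^ 3) < t := by
      rw [map_mul, map_pow]
      calc v 20 * v u ^ 3 ≤ 1 * v u ^ 3 := mul_le_mul' (by exact_mod_cast hle1 20) le_rfl
        _ = v u ^ 3 := one_mul _
        _ < t := hlt
    have l3 : v (126 * u ^ 2) < t := (h126 _ (by rw [map_pow]; exact pow_le_one₀ zero_le hule)).trans_lt ht2t
    have l4 : v ((196 + L) * u) < t := by
      rw [map_mul]
      calc v (196 + L) * v u ≤ t * v u := mul_le_mul' h196 le_rfl
        _ < t * 1 := mul_lt_mul_of_pos_left hult1 ht0'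
        _ = t := mul_one t
    exact Valuation.map_add_lt _ (Valuation.map_sub_lt _ (Valuation.map_add_lt _ l1 l2) l3) l4
  rw [← hid] at hR
  exact absurd h343 hR.ne

/-! ### §2 The two factors of `9(u + 1)² − u⁶` -/

/-- **`v(G₋)·v(G₊) = v(3)²·v(u)²`** for `G₋ = (403 − 8L) + (253 + L)u − 129u²` and
`G₊ = (8L − 283) − (139 + L)u + 123u²`, when `v(403 − 8L) = v(3)`, `v(253 + L) ≤ v(3)`,
`v(8L − 283) ≤ v(3)²`, `v(139 + L) ≤ v(3)²` and `v(u)³ = v(3)`: `v(G₋) = v(3)` (constant term)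
and `v(G₊) = v(123u²) = v(3)v(u)²`. [folklore] -/
theorem valuation_factors_of_quartic_three {u L : AlgebraicClosure ℚ}
    (h403 : (placeOver 3).valuation (403 - 8 * L) = (placeOver 3).valuation (3 : AlgebraicClosure ℚ))
    (h253 : (placeOver 3).valuation (253 + L) ≤ (placeOver 3).valuation (3 : AlgebraicClosure ℚ))
    (h283 : (placeOver 3).valuation (8 * L - 283) ≤
      (placeOver 3).valuation (3 : AlgebraicClosure ℚ) ^ 2)
    (h139 : (placeOver 3).valuation (139 + L) ≤ (placeOver 3).valuation (3 : AlgebraicClosure ℚ) ^ 2)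
    (hu : (placeOver 3).valuation u ^ 3 = (placeOver 3).valuation (3 : AlgebraicClosure ℚ)) :
    (placeOver 3).valuation (403 - 8 * L + (253 + L) * u - 129 * u ^ 2) *
        (placeOver 3).valuation (8 * L - 283 - (139 + L) * u + 123 * u ^ 2) =
      (placeOver 3).valuation (3 : AlgebraicClosure ℚ) ^ 2 * (placeOver 3).valuation u ^ 2 := by
  set v := (placeOver 3).valuation with hv
  set t := v (3 : AlgebraicClosure ℚ) with ht
  set s := v u with hs
  have ht1 : t < 1 := valuation_three_lt_one
  have ht0 : t ≠ 0 := valuation_three_ne_zero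
  have ht0' : 0 < t := zero_lt_iff.mpr ht0
  have hunit : ∀ n : ℤ, ¬ (3 : ℤ) ∣ n → v (n : AlgebraicClosure ℚ) = 1 := fun n hn ↦
    valuation_intCast_eq_one_of_not_dvd hn
  -- orders of magnitude: `t < s < 1`, `s³ = t`
  have hs1 : s < 1 := by
    by_contra h
    rw [not_lt] at h
    have : (1 : _) ≤ s ^ 3 := one_le_pow₀ h
    rw [hu] at this
    exact absurd this (not_le.mpr ht1)
  have hs0' : 0 < s := by
    rcases eq_or_lt_of_le (zero_le : (0 : _) ≤ s) with h | h
    · exfalso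
      have : s ^ 3 = 0 := by rw [← h, zero_pow three_ne_zero]
      rw [hu] at this
      exact ht0 this
    · exact h
  have hts : t < s := by
    refine lt_of_pow_lt_pow_left₀ 3 hs0'.le ?_
    rw [hu]
    calc t ^ 3 = t * t ^ 2 := by rw [← pow_succ']
      _ < t * 1 := mul_lt_mul_of_pos_left (pow_lt_one₀ zero_le ht1 two_ne_zero) ht0'
      _ = t := mul_one t
  have hts2 : t < s ^ 2 := by
    refine lt_of_pow_lt_pow_left₀ 3 (pow_pos hs0' 2).le ?_
    rw [← pow_mul, show 2 * 3 = 3 * 2 from rfl, pow_mul, hu]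
    calc t ^ 3 = t ^ 2 * t := pow_succ _ _
      _ < t ^ 2 * 1 := mul_lt_mul_of_pos_left ht1 (pow_pos ht0' 2)
      _ = t ^ 2 := mul_one _
  -- `G₋`: the constant term dominates
  have hGm : v (403 - 8 * L + (253 + L) * u - 129 * u ^ 2) = t := by
    have hrest : v ((253 + L) * u - 129 * u ^ 2) < v (403 - 8 * L) := by
      rw [h403]
      refine Valuation.map_sub_lt _ ?_ ?_
      · rw [map_mul]
        calc v (253 + L) * s ≤ t * s := mul_le_mul' h253 le_rfl
          _ < t * 1 := mul_lt_mul_of_pos_left hs1 ht0'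
          _ = t := mul_one t
      · rw [show (129 : AlgebraicClosure ℚ) = 3 * 43 by norm_num, map_mul, map_mul, map_pow]
        have h43 : v (43 : AlgebraicClosure ℚ) = 1 := by simpa using hunit 43 (by decide)
        rw [h43, mul_one]
        calc t * s ^ 2 < t * 1 := mul_lt_mul_of_pos_left (pow_lt_one₀ zero_le hs1 two_ne_zero) ht0'
          _ = t := mul_one t
    rw [show (403 - 8 * L + (253 + L) * u - 129 * u ^ 2 : AlgebraicClosure ℚ) =
        403 - 8 * L + ((253 + L) * u - 129 * u ^ 2) by ring,
      Valuation.map_add_eq_of_lt_left _ hrest, h403]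
  -- `G₊`: the quadratic term dominates
  have hGp : v (8 * L - 283 - (139 + L) * u + 123 * u ^ 2) = t * s ^ 2 := by
    have hmain : v (123 * u ^ 2) = t * s ^ 2 := by
      rw [show (123 : AlgebraicClosure ℚ) = 3 * 41 by norm_num, map_mul, map_mul, map_pow]
      have h41 : v (41 : AlgebraicClosure ℚ) = 1 := by simpa using hunit 41 (by decide)
      rw [h41, mul_one]
    have hrest : v (8 * L - 283 - (139 + L) * u) < v (123 * u ^ 2) := by
      rw [hmain]
      refine Valuation.map_sub_lt _ (h283.trans_lt ?_) ?_
      · calc t ^ 2 = t * t := pow_two t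
          _ < t * s ^ 2 := mul_lt_mul_of_pos_left hts2 ht0'
      · rw [map_mul]
        calc v (139 + L) * s ≤ t ^ 2 * s := mul_le_mul' h139 le_rfl
          _ = t * (t * s) := by rw [pow_two, mul_assoc]
          _ < t * (s * s) := mul_lt_mul_of_pos_left (mul_lt_mul_of_pos_right hts hs0') ht0'
          _ = t * s ^ 2 := by rw [pow_two]
    rw [show (8 * L - 283 - (139 + L) * u + 123 * u ^ 2 : AlgebraicClosure ℚ) =
        123 * u ^ 2 + (8 * L - 283 - (139 + L) * u) by ring,
      Valuation.map_add_eq_of_lt_left _ hrest, hmain]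
  rw [hGm, hGp, ← mul_assoc, ← pow_two]

end Summit.BirchSwinnertonDyer.Rank1Residual.GaloisImage
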